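import Mathlib
import Summits.Ventures.PercRepro2.HCov
import Summits.Ventures.PercRepro2.HCovSwap
import Summits.Ventures.PercRepro2.BHKMixed

/-!
# The cross term (J1) at `γ = 1` is a theorem (four instances of BHK06 Thm 1.5)
(blind cell PercRepro2, mine-a g10 — MINE-A.md §53.8)

The lead's cross term (row 2′J1) is `γ · Cov_μ(σ_b, σ₃) ≥ Cov_μ(σ_b, X)` under `μ = P(· | Q)`,
`Q = {a₁ ↮ a₂}`, with `σ_v = 1_{v ∈ C₁} − 1_{v ∈ C₂}`, `X = 1[a₃ ∈ C₁, o ∈ C₂] − 1[a₃ ∈ C₂, o ∈ C₁]`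
and `γ = P(o ∈ U | a₃ ∉ U, Q)`.  Since `σ₃ − X = 1[a₃ ∈ C₁, o ∉ C₂] − 1[a₃ ∈ C₂, o ∉ C₁]` is a
difference of two events that are (increasing in `C₁`, decreasing in `C₂`) resp. (decreasing in
`C₁`, increasing in `C₂`), the inequality **with `γ` replaced by `1`**,

  `Cov_μ(σ_b, σ₃ − X) ≥ 0`,

is a sum of four instances of BHK06 Theorem 1.5 (`bhk_mixed_cluster`, `bhk_mixed_cluster_cross`):
`Cov_μ(1_{bL}, 1[a₃L, o∉C₂]) ≥ 0`, `Cov_μ(1_{bH}, 1[a₃L, o∉C₂]) ≤ 0`, `Cov_μ(1_{bL}, 1[a₃H, o∉C₁]) ≤ 0`,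
`Cov_μ(1_{bH}, 1[a₃H, o∉C₁]) ≥ 0`.  Cleared by `P(Q)²` this is `j1_at_one` below.  The content of
(J1) proper is the share `(1 − γ) · Cov_μ(σ_b, σ₃) ≤ Cov_μ(σ_b, σ₃ − X)` — the coefficient `1` of
BHK 1.5 improved to `γ` (MINE-A.md §53.8: census-true, not a consequence of the classical toolbox on
the marked type table in its `b ∈ C₂`-half).
-/

namespace Summit.Ventures.PercRepro2

open UnionCluster

namespace J1One

section Pieces

variable {V : Type*} {E : Type*} [Fintype E] [DecidableEq E] [Fintype V] [DecidableEq V]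
  {R : Type*} [Field R] [LinearOrder R] [IsStrictOrderedRing R]

omit [Fintype E] [DecidableEq E] [Fintype V] [DecidableEq V] in
/-- `{a₁ ↮ a₂}` spelled as `Q = avoidAll a₂ {a₁}`. -/
lemma compl_conn_eq_Q (ends : E → Sym2 V) (a₁ a₂ : V) :
    (connEvent ends a₁ a₂)ᶜ = avoidAll ends a₂ {a₁} := by
  ext ω
  simp only [Set.mem_compl_iff, mem_connEvent, mem_avoidAll, Finset.mem_singleton, forall_eq]
  exact ⟨fun h hc => h (conn_symm hc), fun h hc => h (conn_symm hc)⟩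

omit [Fintype E] [DecidableEq E] [Fintype V] [DecidableEq V] in
/-- `{a₂ ↮ a₁}` spelled as `Q = avoidAll a₂ {a₁}`. -/
lemma compl_conn_eq_Q' (ends : E → Sym2 V) (a₁ a₂ : V) :
    (connEvent ends a₂ a₁)ᶜ = avoidAll ends a₂ {a₁} := by
  ext ω
  simp only [Set.mem_compl_iff, mem_connEvent, mem_avoidAll, Finset.mem_singleton, forall_eq]

variable (p : E → R) (ends : E → Sym2 V) (o a₁ a₂ a₃ b : V)

/-- **Piece 1** (`bhk_mixed_cluster`, `s = a₁`): `P(Q, bL) · P(Q, a₃L, o ∉ C₂) ≤ P(Q, a₃L, o ∉ C₂, bL) · P(Q)`. -/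
theorem piece_bL_a3L (hp : IsProbVec p) :
    prob p (avoidAll ends a₂ {a₁} ∩ connEvent ends a₁ b) *
        prob p (avoidAll ends a₂ {a₁} ∩ connEvent ends a₁ a₃ ∩ (connEvent ends a₂ o)ᶜ) ≤
      prob p (avoidAll ends a₂ {a₁} ∩ connEvent ends a₁ a₃ ∩ (connEvent ends a₂ o)ᶜ ∩
          connEvent ends a₁ b) * prob p (avoidAll ends a₂ {a₁}) := by
  have h := BHKMixed.bhk_mixed_cluster p hp ends a₁ a₂ (isUpperSet_mem_setOf b) (isUpperSet_mem_setOf a₃)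
    (isUpperSet_mem_setOf o)
  rw [← BHKMixed.clusterInEvent_inter, ← connEvent_eq_clusterInEvent ends a₁ b,
    ← connEvent_eq_clusterInEvent ends a₁ a₃, ← connEvent_eq_clusterInEvent ends a₂ o,
    compl_conn_eq_Q ends a₁ a₂] at h
  have e1 : connEvent ends a₁ b ∩ avoidAll ends a₂ {a₁} =
      avoidAll ends a₂ {a₁} ∩ connEvent ends a₁ b := Set.inter_comm _ _
  have e2 : connEvent ends a₁ a₃ ∩ (connEvent ends a₂ o)ᶜ ∩ avoidAll ends a₂ {a₁} =
      avoidAll ends a₂ {a₁} ∩ connEvent ends a₁ a₃ ∩ (connEvent ends a₂ o)ᶜ := by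
    ext ω; simp only [Set.mem_inter_iff]; tauto
  have e3 : connEvent ends a₁ b ∩ connEvent ends a₁ a₃ ∩ (connEvent ends a₂ o)ᶜ ∩
      avoidAll ends a₂ {a₁} =
      avoidAll ends a₂ {a₁} ∩ connEvent ends a₁ a₃ ∩ (connEvent ends a₂ o)ᶜ ∩ connEvent ends a₁ b := by
    ext ω; simp only [Set.mem_inter_iff]; tauto
  rw [e1, e2, e3] at h
  exact h

/-- **Piece 2** (`bhk_mixed_cluster_cross`, `s = a₁`): `P(Q, a₃L, o ∉ C₂, bH) · P(Q) ≤ P(Q, bH) · P(Q, a₃L, o ∉ C₂)`. -/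
theorem piece_bH_a3L (hp : IsProbVec p) :
    prob p (avoidAll ends a₂ {a₁} ∩ connEvent ends a₁ a₃ ∩ (connEvent ends a₂ o)ᶜ ∩
        connEvent ends a₂ b) * prob p (avoidAll ends a₂ {a₁}) ≤
      prob p (avoidAll ends a₂ {a₁} ∩ connEvent ends a₂ b) *
        prob p (avoidAll ends a₂ {a₁} ∩ connEvent ends a₁ a₃ ∩ (connEvent ends a₂ o)ᶜ) := by
  have h := BHKMixed.bhk_mixed_cluster_cross p hp ends a₁ a₂ (isUpperSet_mem_setOf a₃)
    (isUpperSet_mem_setOf o) (isUpperSet_mem_setOf b)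
  rw [← connEvent_eq_clusterInEvent ends a₁ a₃, ← connEvent_eq_clusterInEvent ends a₂ o,
    ← connEvent_eq_clusterInEvent ends a₂ b, compl_conn_eq_Q ends a₁ a₂] at h
  have e1 : connEvent ends a₁ a₃ ∩ (connEvent ends a₂ o)ᶜ ∩ connEvent ends a₂ b ∩
      avoidAll ends a₂ {a₁} =
      avoidAll ends a₂ {a₁} ∩ connEvent ends a₁ a₃ ∩ (connEvent ends a₂ o)ᶜ ∩ connEvent ends a₂ b := by
    ext ω; simp only [Set.mem_inter_iff]; tauto
  have e2 : connEvent ends a₂ b ∩ avoidAll ends a₂ {a₁} =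
      avoidAll ends a₂ {a₁} ∩ connEvent ends a₂ b := Set.inter_comm _ _
  have e3 : connEvent ends a₁ a₃ ∩ (connEvent ends a₂ o)ᶜ ∩ avoidAll ends a₂ {a₁} =
      avoidAll ends a₂ {a₁} ∩ connEvent ends a₁ a₃ ∩ (connEvent ends a₂ o)ᶜ := by
    ext ω; simp only [Set.mem_inter_iff]; tauto
  rw [e1, e2, e3] at h
  exact h

/-- **Piece 3** (`bhk_mixed_cluster_cross`, `s = a₂`): `P(Q, a₃H, o ∉ C₁, bL) · P(Q) ≤ P(Q, bL) · P(Q, a₃H, o ∉ C₁)`. -/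
theorem piece_bL_a3H (hp : IsProbVec p) :
    prob p (avoidAll ends a₂ {a₁} ∩ connEvent ends a₂ a₃ ∩ (connEvent ends a₁ o)ᶜ ∩
        connEvent ends a₁ b) * prob p (avoidAll ends a₂ {a₁}) ≤
      prob p (avoidAll ends a₂ {a₁} ∩ connEvent ends a₁ b) *
        prob p (avoidAll ends a₂ {a₁} ∩ connEvent ends a₂ a₃ ∩ (connEvent ends a₁ o)ᶜ) := by
  have h := BHKMixed.bhk_mixed_cluster_cross p hp ends a₂ a₁ (isUpperSet_mem_setOf a₃)
    (isUpperSet_mem_setOf o) (isUpperSet_mem_setOf b)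
  rw [← connEvent_eq_clusterInEvent ends a₂ a₃, ← connEvent_eq_clusterInEvent ends a₁ o,
    ← connEvent_eq_clusterInEvent ends a₁ b, compl_conn_eq_Q' ends a₁ a₂] at h
  have e1 : connEvent ends a₂ a₃ ∩ (connEvent ends a₁ o)ᶜ ∩ connEvent ends a₁ b ∩
      avoidAll ends a₂ {a₁} =
      avoidAll ends a₂ {a₁} ∩ connEvent ends a₂ a₃ ∩ (connEvent ends a₁ o)ᶜ ∩ connEvent ends a₁ b := by
    ext ω; simp only [Set.mem_inter_iff]; tauto
  have e2 : connEvent ends a₁ b ∩ avoidAll ends a₂ {a₁} =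
      avoidAll ends a₂ {a₁} ∩ connEvent ends a₁ b := Set.inter_comm _ _
  have e3 : connEvent ends a₂ a₃ ∩ (connEvent ends a₁ o)ᶜ ∩ avoidAll ends a₂ {a₁} =
      avoidAll ends a₂ {a₁} ∩ connEvent ends a₂ a₃ ∩ (connEvent ends a₁ o)ᶜ := by
    ext ω; simp only [Set.mem_inter_iff]; tauto
  rw [e1, e2, e3] at h
  exact h

/-- **Piece 4** (`bhk_mixed_cluster`, `s = a₂`): `P(Q, bH) · P(Q, a₃H, o ∉ C₁) ≤ P(Q, a₃H, o ∉ C₁, bH) · P(Q)`. -/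
theorem piece_bH_a3H (hp : IsProbVec p) :
    prob p (avoidAll ends a₂ {a₁} ∩ connEvent ends a₂ b) *
        prob p (avoidAll ends a₂ {a₁} ∩ connEvent ends a₂ a₃ ∩ (connEvent ends a₁ o)ᶜ) ≤
      prob p (avoidAll ends a₂ {a₁} ∩ connEvent ends a₂ a₃ ∩ (connEvent ends a₁ o)ᶜ ∩
          connEvent ends a₂ b) * prob p (avoidAll ends a₂ {a₁}) := by
  have h := BHKMixed.bhk_mixed_cluster p hp ends a₂ a₁ (isUpperSet_mem_setOf b) (isUpperSet_mem_setOf a₃)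
    (isUpperSet_mem_setOf o)
  rw [← BHKMixed.clusterInEvent_inter, ← connEvent_eq_clusterInEvent ends a₂ b,
    ← connEvent_eq_clusterInEvent ends a₂ a₃, ← connEvent_eq_clusterInEvent ends a₁ o,
    compl_conn_eq_Q' ends a₁ a₂] at h
  have e1 : connEvent ends a₂ b ∩ avoidAll ends a₂ {a₁} =
      avoidAll ends a₂ {a₁} ∩ connEvent ends a₂ b := Set.inter_comm _ _
  have e2 : connEvent ends a₂ a₃ ∩ (connEvent ends a₁ o)ᶜ ∩ avoidAll ends a₂ {a₁} =
      avoidAll ends a₂ {a₁} ∩ connEvent ends a₂ a₃ ∩ (connEvent ends a₁ o)ᶜ := by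
    ext ω; simp only [Set.mem_inter_iff]; tauto
  have e3 : connEvent ends a₂ b ∩ connEvent ends a₂ a₃ ∩ (connEvent ends a₁ o)ᶜ ∩
      avoidAll ends a₂ {a₁} =
      avoidAll ends a₂ {a₁} ∩ connEvent ends a₂ a₃ ∩ (connEvent ends a₁ o)ᶜ ∩ connEvent ends a₂ b := by
    ext ω; simp only [Set.mem_inter_iff]; tauto
  rw [e1, e2, e3] at h
  exact h

/-- **(J1) at `γ = 1`** (cleared by `P(Q)²`): with `σ₃ − X = 1[a₃L, o∉C₂] − 1[a₃H, o∉C₁]`,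
`E[σ_b 1_Q] · E[(σ₃ − X) 1_Q] ≤ E[σ_b (σ₃ − X) 1_Q] · P(Q)`, i.e. `Cov_μ(σ_b, σ₃ − X) ≥ 0`
— the sum of the four BHK 1.5 pieces. -/
theorem j1_at_one (hp : IsProbVec p) :
    (prob p (avoidAll ends a₂ {a₁} ∩ connEvent ends a₁ b) -
        prob p (avoidAll ends a₂ {a₁} ∩ connEvent ends a₂ b)) *
      (prob p (avoidAll ends a₂ {a₁} ∩ connEvent ends a₁ a₃ ∩ (connEvent ends a₂ o)ᶜ) -
        prob p (avoidAll ends a₂ {a₁} ∩ connEvent ends a₂ a₃ ∩ (connEvent ends a₁ o)ᶜ)) ≤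
    (prob p (avoidAll ends a₂ {a₁} ∩ connEvent ends a₁ a₃ ∩ (connEvent ends a₂ o)ᶜ ∩
          connEvent ends a₁ b) -
        prob p (avoidAll ends a₂ {a₁} ∩ connEvent ends a₁ a₃ ∩ (connEvent ends a₂ o)ᶜ ∩
          connEvent ends a₂ b) -
        prob p (avoidAll ends a₂ {a₁} ∩ connEvent ends a₂ a₃ ∩ (connEvent ends a₁ o)ᶜ ∩
          connEvent ends a₁ b) +
        prob p (avoidAll ends a₂ {a₁} ∩ connEvent ends a₂ a₃ ∩ (connEvent ends a₁ o)ᶜ ∩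
          connEvent ends a₂ b)) * prob p (avoidAll ends a₂ {a₁}) := by
  have h1 := piece_bL_a3L p ends o a₁ a₂ a₃ b hp
  have h2 := piece_bH_a3L p ends o a₁ a₂ a₃ b hp
  have h3 := piece_bL_a3H p ends o a₁ a₂ a₃ b hp
  have h4 := piece_bH_a3H p ends o a₁ a₂ a₃ b hp
  nlinarith [h1, h2, h3, h4]

end Pieces

end J1One

end Summit.Ventures.PercRepro2
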